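import Summits.QuantumAdvantage.QuantumAdvantage.Theses.CubicForrelation
import Literature.Computability.QuantumComplexity.SignedForrelationMem

/-!
# `SignedCubicForrelationMemPromiseBQP` holds — support `stmt-QuantumAdvantage-13934` (route `CubicForrelation`)

The route decl
`Summit.QuantumAdvantage.QuantumAdvantage.Theses.CubicForrelation.SignedCubicForrelationMemPromiseBQP`
says: SIGNED cubic explicit 2-fold Forrelation (codes of `k = 2`-fold Forrelation instances with `n`
even and both `B₂`-circuits computing Boolean functions of `𝔽₂`-degree `≤ 3`; YES `Φ ≥ 3/5`, NO
`Φ ≤ -3/5`) lies in `PromiseBQP`. By `rfl` (`signedCubicForrelationProblem_two_eq`) this is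
`signedCubicForrelationProblem 2 ∈ PromiseBQP`, the Literature theorem
`Literature.Computability.QuantumComplexity.signedCubicForrelationProblem_two_mem_PromiseBQP`
(`SignedForrelationMem.lean`), a sub-promise of `signedForrelationProblem_mem_PromiseBQP` — the
white-box Hadamard test of Aaronson–Ambainis 2018, §3.2 Prop. 6 at `k = 2`, realised in the tree's
phase-query framework (`PhaseQuery*.lean`) by ONE control wire and three phase layers with full
Hadamard layers: predicates `c ∧ (C₀ ⊕ C₁(0))`, `C₁ ⊕ q`, `c ∧ q` with `q` the (self-dual bent) inner
product of the two halves of the data wires, whose 3-fold forrelation is exactly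
`(-1)^{C₁(0)} (1 + Φ)/2` (`SgnForrMem.kForrelationValue_gadget`, `SignedForrelationGadget.lean`);
inside the promise at most one wire is idle, so the modulus is `(1 + Φρ)/2`, `ρ ∈ {1, 1/√2}`, giving
acceptance `1 − (1 − M²)³ ≥ 2/3` on YES and `≤ 1/3` on NO (`SgnForrMem.accept_yes/accept_no`).
Sources: [AaronsonAmbainis2018] §3.2 Prop. 6 (arXiv:1411.5729 pp. 11–12), §6 (p. 26).
-/

set_option linter.dupNamespace false -- D-0017: single-problem summit ⇒ `QuantumAdvantage.QuantumAdvantage` by design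

namespace Summit.QuantumAdvantage.QuantumAdvantage.Theorems

open Literature.Computability.QuantumComplexity

/-- **Support `SignedCubicForrelationMemPromiseBQP` (stmt-QuantumAdvantage-13934) holds**: signed
cubic 2-fold Forrelation (`k = 2`, `n` even, degree `≤ 3`; YES `Φ ≥ 3/5`, NO `Φ ≤ -3/5`) is in
`PromiseBQP` — the route decl unfolds by `rfl` to `signedCubicForrelationProblem 2 ∈ PromiseBQP`, the
Literature theorem `signedCubicForrelationProblem_two_mem_PromiseBQP` (the one-control-wire
Hadamard-test phase-query family of Aaronson–Ambainis 2018, §3.2 Prop. 6, acceptance governed by the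
exact amplitude `(-1)^{C₁(0)}(1 + Φρ)/2`). -/
theorem SignedCubicForrelationMemPromiseBQP_proof :
    Summit.QuantumAdvantage.QuantumAdvantage.Theses.CubicForrelation.SignedCubicForrelationMemPromiseBQP :=
  signedCubicForrelationProblem_two_mem_PromiseBQP

end Summit.QuantumAdvantage.QuantumAdvantage.Theorems
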